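import Literature.AnabelianGeometry.EtaleTheta.Discharge.Sec1Thm110iOfDecompTransport
import Literature.AnabelianGeometry.EtaleTheta.Thm110HypothesisRefl
import HarnessLib

/-!
# Relative NON-VACUITY of the inputs of `thm110i_of_matching` / `thm110ii_of_decompTransport`:
# the identity witness (K2, abc-iut-w5-d140; hygiene for the NV census)

[EtTh] Thm. 1.10 p.255–256 [cite: MochizukiEtTh2009, Thm 1.10 p.29].  PROOF-ONLY.  The kernel routes
p428966 (`thm110ii_of_decompTransport`) and p429307 (`thm110i_of_matching`) take, beyond anchored standard
data and Prop. 1.5 (ii), the NAMED inputs `Thm110DeltaInduced H δ`, `Thm110DeltaCompat δ` and the matching of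
the 4-torsion decomposition groups.  This file certifies that these inputs are JOINTLY SATISFIABLE relative to
the data: at `α = β`, `γ = id` (abc-iut-w5-d062's identity witness of `Thm110Hypothesis`, rebuilt here as a
term), `δ = id` is induced (`transport_refl`), compatible, and the matching holds with `σ = σ' = 1` — for EVERY
`MuTwoSetting`, admissible `ε_Z`, `Compat`, étale theta datum and anchored standard data.  Consistency
evidence only (the identity is not an interesting `γ`); the absolute non-vacuity of the data themselves
(`EtaleThetaData`, `AnchoredStandardData`, `Prop15ii`) is the genuine-model question of the NV census
(KummerData is EMPTY at the discrete root model, abc-iut-w5-d171 p424679).  Nothing of [EtTh] is asserted;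
no side taken on [IUTchIII] Cor. 3.12.
-/

noncomputable section

namespace Literature.AnabelianGeometry.EtaleTheta

open Literature.AnabelianGeometry.SemiGraphs

namespace MuTwoSetting

variable {p : ℕ} [Fact p.Prime] (M : MuTwoSetting p)

/-- **The inputs of `thm110i_of_matching` are jointly satisfiable at the identity**: for `γ = id` there are
a `Thm110Hypothesis` `H` (identity extension, identity companion) and `δ = id` with `Thm110DeltaInduced H δ`,
`Thm110DeltaCompat δ`, and the matching of `(D_τ, D_{τ⁻¹})` with `σ = σ' = 1`.
[cite: MochizukiEtTh2009, Thm 1.10 p.29] -/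
theorem thm110i_inputs_refl {εZ : M.GtpC} (hZ : M.IsAdmissibleEpsZ εZ) (hC : M.toThetaSetting.Compat)
    (E : M.toThetaSetting.EtaleThetaData) (A : M.AnchoredStandardData E.toKummerData) :
    ∃ (H : Thm110Hypothesis εZ εZ hC hC E E (ContinuousMulEquiv.refl (M.dotC εZ)))
      (δ : (↥M.Kdd)ˣ ≃* (↥M.Kdd)ˣ),
      Thm110DeltaInduced H δ ∧ Thm110DeltaCompat (Mα := M) (Mβ := M) δ ∧
      ∃ σ σ' : M.PiTemp, M.inclX σ ∈ M.dotX εZ ∧ M.inclX σ' ∈ M.dotX εZ ∧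
        ((A.tau.Dpt.map H.γX.toMulEquiv.toMonoidHom = A.tau.Dpt.map (MulAut.conj σ).toMonoidHom ∧
          A.tauInv.Dpt.map H.γX.toMulEquiv.toMonoidHom =
            A.tauInv.Dpt.map (MulAut.conj σ').toMonoidHom) ∨
         (A.tau.Dpt.map H.γX.toMulEquiv.toMonoidHom = A.tauInv.Dpt.map (MulAut.conj σ).toMonoidHom ∧
          A.tauInv.Dpt.map H.γX.toMulEquiv.toMonoidHom =
            A.tau.Dpt.map (MulAut.conj σ').toMonoidHom)) := by
  let H : Thm110Hypothesis εZ εZ hC hC E E (ContinuousMulEquiv.refl (M.dotC εZ)) :=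
    { admα := hZ
      admβ := hZ
      Γ := ContinuousMulEquiv.refl M.GtpC
      preserves := M.preservesCoverings_refl εZ
      restricts := ⟨1, fun x => by rw [inv_one, mul_one, one_mul]; rfl⟩
      γX := ContinuousMulEquiv.refl M.PiTemp
      γX_spec := fun _ => rfl
      thm16i := ThetaSetting.thm16i_refl M.toThetaSetting
      companion := ThetaSetting.ThetaCompanion.ofRefl M.toThetaSetting
      maps_orbit := fun y => by
        constructor
        · intro hy
          exact ⟨y, hy, (ThetaSetting.transport_refl _ _ y).symm⟩
        · rintro ⟨x, hx, rfl⟩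
          rw [ThetaSetting.transport_refl]
          exact hx }
  have hone : M.inclX 1 ∈ M.dotX εZ := by rw [map_one]; exact (M.dotX εZ).one_mem
  have hmap : ∀ K : Subgroup M.PiTemp,
      K.map H.γX.toMulEquiv.toMonoidHom = K.map (MulAut.conj (1 : M.PiTemp)).toMonoidHom := fun K => by
    rw [map_one]
    rfl
  refine ⟨H, MulEquiv.refl _, fun a => ThetaSetting.transport_refl _ _ _,
    ⟨fun u => Iff.rfl, fun v w => Iff.rfl, fun v => Iff.rfl⟩, 1, 1, hone, hone,
    Or.inl ⟨hmap A.tau.Dpt, hmap A.tauInv.Dpt⟩⟩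

/-- Hence, at the identity, **`Thm110i` and `Thm110ii` are concluded by the K2 routes from anchored standard
data and Prop. 1.5 (ii) alone** (no further named input) — the composition is exercised end to end.
[cite: MochizukiEtTh2009, Thm 1.10 p.29] -/
theorem thm110i_and_ii_refl {εZ : M.GtpC} (hZ : M.IsAdmissibleEpsZ εZ) (hC : M.toThetaSetting.Compat)
    (E : M.toThetaSetting.EtaleThetaData) (A : M.AnchoredStandardData E.toKummerData)
    (h15ii : ThetaSetting.Prop15ii E.toKummerData hC) :
    ∃ H : Thm110Hypothesis εZ εZ hC hC E E (ContinuousMulEquiv.refl (M.dotC εZ)),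
      Thm110i H A.toStandardData A.toStandardData ∧ Thm110ii H A.toStandardData A.toStandardData := by
  obtain ⟨H, δ, hδ, hcompat, hmatch⟩ := M.thm110i_inputs_refl hZ hC E A
  exact ⟨H, thm110i_of_matching H A A h15ii h15ii δ hδ hcompat hmatch,
    thm110ii_of_matching H A A h15ii h15ii δ hδ hmatch⟩

end MuTwoSetting

end Literature.AnabelianGeometry.EtaleTheta

end
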